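import Mathlib
import HarnessLib
import Summits.Ventures.LatticeQCDFlow.Scoring.UStatisticRowMeans

/-!
# Sen's estimator of the projection variance `ζ₁` of an order-2 U-statistic is CONSISTENT IN
# PROBABILITY under a square-integrable kernel: `V̂ₙ = (1/n) Σᵢ (Ĥᵢ − Uₙ)² → ζ₁`,
# `Ĥᵢ = Σ_{j ≠ i} F(xᵢ, xⱼ)/(n − 1)` the row means — the moment input of Hoeffding's CLT
# estimated from the same data

HONEST FRAMING: exact (Metropolis-corrected) sampling algorithms for lattice gauge theory;
figures of merit are autocorrelation/cost numbers at stated couplings and volumes; no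
continuum-physics claim.

Venture `LatticeQCDFlow` (cell pub-lqcd), topic `Scoring`; FANOUT row 4 (`s0-u1-b`, rung S0-B).
Sequel of `Scoring/UStatisticStrongLaw` and `Scoring/UStatisticCLT`: Hoeffding's CLT
`√n (Uₙ − μ_F) ⇒ N(0, 4ζ₁)` has the unknown moment `ζ₁ = Var_ν h = ∫ h² dν − μ_F²`
(`h(a) = ∫ F(a, b) dν(b)` Hoeffding's projection) in its limit law, and "estimating the moment
inputs from data" was left NOT CLAIMED.  This file proves that the natural plug-in — P. K. Sen's
estimator, the empirical variance of the ROW MEANS `Ĥᵢ = Σ_{j<n, j≠i} F(xᵢ, xⱼ)/(n − 1)` about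
their average `Uₙ` (for order 2 Arvesen's delete-one jackknife variance estimate is
`4(n − 1)/(n − 2)² · Σᵢ (Ĥᵢ − Uₙ)²`, the same object up to the factor) — converges to `ζ₁` IN
PROBABILITY along an i.i.d. stream, for every symmetric measurable kernel `F ∈ L²(ν ⊗ ν)` and
nothing else.  Route (the algebra is `Scoring/UStatisticRowMeans`, imported): `Ĥᵢ = h(xᵢ) + ẽᵢ`
exactly, with `ẽᵢ = Σ_{j≠i} G̃(xᵢ, xⱼ)/(n − 1)` and `G̃(a, b) = F(a, b) − h(a)` conditionally
centred; hence `E[G̃(xᵢ, xⱼ)G̃(xᵢ, xₖ)] = 0` for distinct `j, k` (row 3's shared-index moment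
`integral_kernel_mul_kernel_shared_iid`) and `E[(1/n)Σᵢ ẽᵢ²] = ∫ G̃²/(n − 1) → 0`, so the
mean square of the errors vanishes IN PROBABILITY (Markov); the empirical variance of `h(xᵢ)`
about `Uₙ` tends to `ζ₁` ALMOST SURELY (Mathlib's strong law for `h²`, row 4's
`ustat₂_tendsto_ae` for `Uₙ`); the two are `2√(MS(h)·MS(ẽ)) + MS(ẽ)` apart, and the
subsequence criterion for convergence in probability (`exists_seq_tendstoInMeasure_atTop_iff`)
assembles them.  Printed counterparts NAMED ONLY (nothing cited as a fact): Sen, Calcutta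
Statist. Assoc. Bull. 10 (1960) 1–18; Arvesen, Ann. Math. Statist. 40 (1969) 2076–2100
(jackknifing U-statistics); Serfling (1980) §5.7; Lee, *U-statistics* (1990) §5.1.  NEW WORK of
the cell (our formalisation); no definition is introduced.

## Content (`ν` a law on `X`; stream `x : ℕ → Ω → X` independent with laws `ν`; on the prefix
## of length `n`: `Uₙ = Σ_{i≠j} F(xᵢ, xⱼ)/(n(n−1))`, `Ĥᵢ = Σ_{j≠i} F(xᵢ, xⱼ)/(n−1)`,
## `V̂ₙ = Σᵢ (Ĥᵢ − Uₙ)²/n`; `μ_F = ∫ F d(ν⊗ν)`, `c₁ = ∫ h² dν`, `ζ₁ = c₁ − μ_F²`)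

§3 `integrable_rowSum_sq`, `integrable_meanSqErr`, **`integral_meanSqErr_eq`**
(`E[(1/n)Σᵢẽᵢ²] = ∫G̃²/(n−1)`, `n ≥ 2`), `tendstoInMeasure_zero_of_integral_le` (Markov),
**`meanSqErr_tendstoInMeasure_zero`**.
§4 `measurable_senVariance`, `meanSqProj_tendsto_ae`, **`senVariance_tendstoInMeasure`** —
THE THEOREM: `V̂ₙ → ζ₁` in probability.

NOT CLAIMED: almost-sure consistency (true under the same hypothesis via the first-moment strong
law for U-statistics of order 3, which the tree does not have); the studentised CLT (next file);
higher orders; any number of ours re-scored.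
-/

noncomputable section

namespace Summit.Ventures.LatticeQCDFlow.Scoring.CardConsistency

open MeasureTheory ProbabilityTheory Finset Real Filter
open scoped Topology Function ENNReal

/-! ## §3 The mean square of the row-mean errors vanishes in probability -/

section MeanSqErr

variable {Ω : Type*} [MeasurableSpace Ω] {P : Measure Ω} [IsProbabilityMeasure P]
variable {X : Type*} [MeasurableSpace X] {ν : Measure X} {x : ℕ → Ω → X}

/-- The squared row sums of a square-integrable kernel are integrable:
`(Σ_{j≠i} G(xᵢ, xⱼ))² ∈ L¹(P)`. [ours] -/
theorem integrable_rowSum_sq (hxm : ∀ i, Measurable (x i)) (hind : iIndepFun x P)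
    (hlaw : ∀ i, Measure.map (x i) P = ν) {G : X → X → ℝ}
    (hG2 : MemLp (fun z : X × X => G z.1 z.2) 2 (ν.prod ν)) {n : ℕ} (i : Fin n) :
    Integrable (fun ω => (∑ j ∈ univ.erase i, G (x i ω) (x j ω)) ^ 2) P := by
  have hexp : (fun ω => (∑ j ∈ univ.erase i, G (x i ω) (x j ω)) ^ 2) = fun ω =>
      ∑ j ∈ univ.erase i, ∑ k ∈ univ.erase i, G (x i ω) (x j ω) * G (x i ω) (x k ω) :=
    funext fun ω => by rw [sq, sum_mul_sum]
  rw [hexp]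
  exact integrable_finsetSum _ fun j hj => integrable_finsetSum _ fun k hk =>
    integrable_kernel_mul_kernel_iid (x := fun (i : Fin n) ω => x i ω) (fun i => hxm _)
      (iIndepFun_prefix hind n) (fun i => hlaw _) hG2 (ne_of_mem_erase hj).symm
      (ne_of_mem_erase hk).symm

/-- The mean square of the row-mean errors is integrable. [ours] -/
theorem integrable_meanSqErr (hxm : ∀ i, Measurable (x i)) (hind : iIndepFun x P)
    (hlaw : ∀ i, Measure.map (x i) P = ν) {F : X → X → ℝ}
    (hFm : Measurable fun z : X × X => F z.1 z.2)
    (hF2 : MemLp (fun z : X × X => F z.1 z.2) 2 (ν.prod ν)) (n : ℕ) :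
    Integrable (fun ω => (∑ i : Fin n, ((∑ j ∈ univ.erase i,
        (F (x i ω) (x j ω) - ∫ b, F (x i ω) b ∂ν)) / ((n : ℝ) - 1)) ^ 2) / (n : ℝ)) P := by
  haveI hν : IsProbabilityMeasure ν := by
    rw [← hlaw 0]
    exact Measure.isProbabilityMeasure_map (hxm 0).aemeasurable
  have hG2 := memLp_centredKernel_two hFm hF2
  have h := fun i : Fin n =>
    integrable_rowSum_sq hxm hind hlaw (G := fun a b => F a b - ∫ b', F a b' ∂ν) hG2 i
  refine (integrable_finsetSum _ fun i _ => ?_).div_const _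
  have e : (fun ω => ((∑ j ∈ univ.erase i, (F (x i ω) (x j ω) - ∫ b, F (x i ω) b ∂ν))
      / ((n : ℝ) - 1)) ^ 2) = fun ω => (∑ j ∈ univ.erase i,
        (F (x i ω) (x j ω) - ∫ b, F (x i ω) b ∂ν)) ^ 2 / ((n : ℝ) - 1) ^ 2 :=
    funext fun ω => by rw [div_pow]
  rw [e]
  exact (h i).div_const _

/-- **The expected mean square of the row-mean errors is `∫ G̃²/(n − 1)`**: for `n ≥ 2`,
`E[(1/n) Σᵢ (Σ_{j≠i} G̃(xᵢ, xⱼ)/(n−1))²] = (∫ G̃² d(ν⊗ν))/(n − 1)` — the `(n−1)(n−2)` cross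
moments `E[G̃(xᵢ, xⱼ)G̃(xᵢ, xₖ)]`, `j ≠ k`, all vanish by conditional centring, the `n − 1`
squares contribute `∫ G̃²` each. [ours] -/
theorem integral_meanSqErr_eq (hxm : ∀ i, Measurable (x i)) (hind : iIndepFun x P)
    (hlaw : ∀ i, Measure.map (x i) P = ν) {F : X → X → ℝ}
    (hFm : Measurable fun z : X × X => F z.1 z.2)
    (hF2 : MemLp (fun z : X × X => F z.1 z.2) 2 (ν.prod ν)) {n : ℕ} (hn : 2 ≤ n) :
    ∫ ω, (∑ i : Fin n, ((∑ j ∈ univ.erase i, (F (x i ω) (x j ω) - ∫ b, F (x i ω) b ∂ν))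
        / ((n : ℝ) - 1)) ^ 2) / (n : ℝ) ∂P
      = (∫ z, (F z.1 z.2 - ∫ b, F z.1 b ∂ν) ^ 2 ∂(ν.prod ν)) / ((n : ℝ) - 1) := by
  haveI hν : IsProbabilityMeasure ν := by
    rw [← hlaw 0]
    exact Measure.isProbabilityMeasure_map (hxm 0).aemeasurable
  -- name the centred kernel
  obtain ⟨G, hG⟩ : ∃ G : X → X → ℝ, ∀ a b, G a b = F a b - ∫ b', F a b' ∂ν :=
    ⟨fun a b => F a b - ∫ b', F a b' ∂ν, fun _ _ => rfl⟩
  simp only [← hG]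
  have hGm : Measurable fun z : X × X => G z.1 z.2 := by
    simp only [hG]
    exact measurable_centredKernel hFm
  have hG2 : MemLp (fun z : X × X => G z.1 z.2) 2 (ν.prod ν) := by
    simp only [hG]
    exact memLp_centredKernel_two hFm hF2
  have hc1 : ∫ a, (∫ b, G a b ∂ν) ^ 2 ∂ν = 0 := by
    simp only [hG]
    exact integral_sq_centredKernel_section_eq_zero
  set γ : ℝ := ∫ z, G z.1 z.2 ^ 2 ∂(ν.prod ν) with hγ
  -- the prefix of length `n` as a finite independent family
  have hxm' : ∀ i : Fin n, Measurable (fun ω => x i ω) := fun i => hxm _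
  have hind' : iIndepFun (fun (i : Fin n) ω => x i ω) P := iIndepFun_prefix hind n
  have hlaw' : ∀ i : Fin n, Measure.map (fun ω => x i ω) P = ν := fun i => hlaw _
  have h2 : (2 : ℝ) ≤ n := by exact_mod_cast hn
  have hn0 : (n : ℝ) ≠ 0 := by positivity
  have hn1 : (n : ℝ) - 1 ≠ 0 := by
    intro h
    linarith
  -- pairwise products of error terms are integrable
  have hInt : ∀ i : Fin n, ∀ j ∈ univ.erase i, ∀ k ∈ univ.erase i,
      Integrable (fun ω => G (x i ω) (x j ω) * G (x i ω) (x k ω)) P := by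
    intro i j hj k hk
    exact integrable_kernel_mul_kernel_iid hxm' hind' hlaw' hG2 (ne_of_mem_erase hj).symm
      (ne_of_mem_erase hk).symm
  -- the expected square of one row sum: `(n − 1)·γ`
  have hrow : ∀ i : Fin n,
      ∫ ω, (∑ j ∈ univ.erase i, G (x i ω) (x j ω)) ^ 2 ∂P = ((n : ℝ) - 1) * γ := by
    intro i
    have hexp : ∀ ω, (∑ j ∈ univ.erase i, G (x i ω) (x j ω)) ^ 2
        = ∑ j ∈ univ.erase i, ∑ k ∈ univ.erase i, G (x i ω) (x j ω) * G (x i ω) (x k ω) :=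
      fun ω => by rw [sq, sum_mul_sum]
    simp_rw [hexp]
    rw [integral_finsetSum _ fun j hj => integrable_finsetSum _ fun k hk => hInt i j hj k hk]
    have hj : ∀ j ∈ univ.erase i,
        ∫ ω, ∑ k ∈ univ.erase i, G (x i ω) (x j ω) * G (x i ω) (x k ω) ∂P = γ := by
      intro j hj
      have hij : i ≠ j := (ne_of_mem_erase hj).symm
      rw [integral_finsetSum _ fun k hk => hInt i j hj k hk]
      have hk : ∀ k ∈ univ.erase i, ∫ ω, G (x i ω) (x j ω) * G (x i ω) (x k ω) ∂P
          = if k = j then γ else 0 := by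
        intro k hk
        have hik : i ≠ k := (ne_of_mem_erase hk).symm
        split_ifs with hkj
        · rw [hkj]
          exact integral_kernel_mul_self_iid hxm' hind' hlaw' hGm hij
        · rw [integral_kernel_mul_kernel_shared_iid hxm' hind' hlaw' hGm hG2 hij hik
            (Ne.symm hkj)]
          exact hc1
      rw [sum_congr rfl hk]
      simp only [sum_ite_eq', hj, if_true]
    rw [sum_congr rfl hj, sum_const, nsmul_eq_mul, card_erase_of_mem (mem_univ i), card_univ,
      Fintype.card_fin, Nat.cast_sub (by omega), Nat.cast_one]
  have hIrow : ∀ i : Fin n, Integrable (fun ω => (∑ j ∈ univ.erase i, G (x i ω) (x j ω)) ^ 2) P :=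
    fun i => integrable_rowSum_sq hxm hind hlaw hG2 i
  -- assemble
  have e : ∀ ω, (∑ i : Fin n, ((∑ j ∈ univ.erase i, G (x i ω) (x j ω)) / ((n : ℝ) - 1)) ^ 2)
      / (n : ℝ)
      = (∑ i : Fin n, (∑ j ∈ univ.erase i, G (x i ω) (x j ω)) ^ 2) / (((n : ℝ) - 1) ^ 2 * n) := by
    intro ω
    simp only [div_pow]
    rw [← sum_div, div_div]
  simp_rw [e]
  rw [integral_div, integral_finsetSum _ fun i _ => hIrow i, sum_congr rfl fun i _ => hrow i,
    sum_const, card_univ, Fintype.card_fin, nsmul_eq_mul,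
    div_eq_div_iff (mul_ne_zero (pow_ne_zero 2 hn1) hn0) hn1]
  ring

omit [IsProbabilityMeasure P] in
/-- **Markov ⇒ convergence in probability**: `fₙ ≥ 0` with, eventually, `fₙ ∈ L¹(P)` and
`E fₙ ≤ bₙ → 0` ⇒ `fₙ → 0` in probability. [folklore] -/
theorem tendstoInMeasure_zero_of_integral_le [IsFiniteMeasure P] {f : ℕ → Ω → ℝ}
    (hf0 : ∀ n ω, 0 ≤ f n ω) {b : ℕ → ℝ} (hb : Tendsto b atTop (𝓝 0))
    (hle : ∀ᶠ n in atTop, Integrable (f n) P ∧ ∫ ω, f n ω ∂P ≤ b n) :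
    TendstoInMeasure P f atTop (fun _ => (0 : ℝ)) := by
  rw [tendstoInMeasure_iff_norm]
  intro ε hε
  have hup : Tendsto (fun n : ℕ => ENNReal.ofReal (b n / ε)) atTop (𝓝 0) := by
    rw [← ENNReal.ofReal_zero]
    exact ENNReal.tendsto_ofReal (by simpa using hb.div_const ε)
  refine tendsto_of_tendsto_of_tendsto_of_le_of_le' tendsto_const_nhds hup
    (Eventually.of_forall fun n => zero_le) ?_
  filter_upwards [hle] with n hn
  have hset : {ω | ε ≤ ‖f n ω - 0‖} = {ω | ε ≤ f n ω} := by
    ext ω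
    simp only [Set.mem_setOf_eq, sub_zero, Real.norm_eq_abs, abs_of_nonneg (hf0 n ω)]
  rw [hset]
  have hmarkov := mul_meas_ge_le_integral_of_nonneg (Eventually.of_forall (hf0 n)) hn.1 ε
  have hreal : P.real {ω | ε ≤ f n ω} ≤ b n / ε := by
    rw [le_div_iff₀ hε, mul_comm]
    exact hmarkov.trans hn.2
  have hb0 : 0 ≤ b n / ε := le_trans measureReal_nonneg hreal
  exact (ENNReal.le_ofReal_iff_toReal_le (measure_ne_top P _) hb0).2 hreal

/-- **The mean square of the row-mean errors vanishes in probability**: for an independent stream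
with common law `ν` and a measurable kernel `F ∈ L²(ν ⊗ ν)`,
`(1/n) Σᵢ (Σ_{j≠i} G̃(xᵢ, xⱼ)/(n−1))² → 0` in probability (Markov's inequality with
`integral_meanSqErr_eq`). [ours] -/
theorem meanSqErr_tendstoInMeasure_zero (hxm : ∀ i, Measurable (x i)) (hind : iIndepFun x P)
    (hlaw : ∀ i, Measure.map (x i) P = ν) {F : X → X → ℝ}
    (hFm : Measurable fun z : X × X => F z.1 z.2)
    (hF2 : MemLp (fun z : X × X => F z.1 z.2) 2 (ν.prod ν)) :
    TendstoInMeasure P (fun (n : ℕ) ω =>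
        (∑ i : Fin n, ((∑ j ∈ univ.erase i, (F (x i ω) (x j ω) - ∫ b, F (x i ω) b ∂ν))
          / ((n : ℝ) - 1)) ^ 2) / (n : ℝ)) atTop (fun _ => (0 : ℝ)) := by
  set γ : ℝ := ∫ z, (F z.1 z.2 - ∫ b, F z.1 b ∂ν) ^ 2 ∂(ν.prod ν) with hγ
  refine tendstoInMeasure_zero_of_integral_le
    (fun n ω => div_nonneg (sum_nonneg fun i _ => sq_nonneg _) (Nat.cast_nonneg n))
    (b := fun n => γ / ((n : ℝ) - 1)) ?_ ?_
  · exact Tendsto.div_atTop tendsto_const_nhds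
      (tendsto_atTop_add_const_right _ _ tendsto_natCast_atTop_atTop)
  · filter_upwards [eventually_ge_atTop 2] with n hn
    exact ⟨integrable_meanSqErr hxm hind hlaw hFm hF2 n,
      (integral_meanSqErr_eq hxm hind hlaw hFm hF2 hn).le⟩

end MeanSqErr

/-! ## §4 Sen's estimator is consistent in probability -/

section Sen

variable {Ω : Type*} [MeasurableSpace Ω] {P : Measure Ω} [IsProbabilityMeasure P]
variable {X : Type*} [MeasurableSpace X] {ν : Measure X} {x : ℕ → Ω → X}

omit [IsProbabilityMeasure P] in
/-- Sen's estimator is a measurable function of the sample. [ours] -/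
theorem measurable_senVariance (hxm : ∀ i, Measurable (x i)) {F : X → X → ℝ}
    (hFm : Measurable fun z : X × X => F z.1 z.2) (n : ℕ) :
    Measurable fun ω => (∑ i : Fin n, ((∑ j ∈ univ.erase i, F (x i ω) (x j ω)) / ((n : ℝ) - 1)
        - (∑ z ∈ (univ : Finset (Fin n)).offDiag, F (x z.1 ω) (x z.2 ω)) / (n * (n - 1) : ℝ)) ^ 2)
      / (n : ℝ) := by
  refine Measurable.div_const (Finset.measurable_sum _ fun i _ => ?_) _
  refine Measurable.pow_const (Measurable.sub ?_ ?_) _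
  · refine Measurable.div_const (Finset.measurable_sum _ fun j _ => ?_) _
    exact hFm.comp ((hxm i).prodMk (hxm j))
  · exact measurable_ustat₂_iid (x := fun (i : Fin n) ω => x i ω) (fun i => hxm _) hFm

/-- **The mean square of the projections is strongly consistent**: `(1/n) Σ_{i<n} h(xᵢ)² → ∫ h² dν`
almost surely (`h ∈ L²(ν)`; Mathlib's strong law). [ours] -/
theorem meanSqProj_tendsto_ae (hxm : ∀ i, Measurable (x i)) (hind : iIndepFun x P)
    (hlaw : ∀ i, Measure.map (x i) P = ν) {F : X → X → ℝ}
    (hFm : Measurable fun z : X × X => F z.1 z.2)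
    (hF2 : MemLp (fun z : X × X => F z.1 z.2) 2 (ν.prod ν)) :
    ∀ᵐ ω ∂P, Tendsto (fun n : ℕ => (∑ i : Fin n, (∫ b, F (x i ω) b ∂ν) ^ 2) / (n : ℝ)) atTop
      (𝓝 (∫ a, (∫ b, F a b ∂ν) ^ 2 ∂ν)) := by
  haveI hν : IsProbabilityMeasure ν := by
    rw [← hlaw 0]
    exact Measure.isProbabilityMeasure_map (hxm 0).aemeasurable
  have hhm : Measurable fun a => ∫ b, F a b ∂ν := (stronglyMeasurable_condMean hFm).measurable
  have hgm : Measurable fun a => (∫ b, F a b ∂ν) ^ 2 := hhm.pow_const 2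
  have hid : ∀ i, IdentDistrib (fun ω => (∫ b, F (x i ω) b ∂ν) ^ 2)
      (fun ω => (∫ b, F (x 0 ω) b ∂ν) ^ 2) P P := fun i =>
    ({ aemeasurable_fst := (hxm i).aemeasurable
       aemeasurable_snd := (hxm 0).aemeasurable
       map_eq := by rw [hlaw, hlaw] } : IdentDistrib (x i) (x 0) P P).comp hgm
  have hint : Integrable (fun ω => (∫ b, F (x 0 ω) b ∂ν) ^ 2) P := by
    have h : Integrable (fun a => (∫ b, F a b ∂ν) ^ 2) (Measure.map (x 0) P) := by
      rw [hlaw]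
      exact (memLp_condMean_two hFm hF2).integrable_sq
    exact h.comp_measurable (hxm 0)
  have h := strong_law_ae_real (μ := P) (fun i ω => (∫ b, F (x i ω) b ∂ν) ^ 2) hint
    (fun i j hij => (hind.indepFun hij).comp hgm hgm) hid
  have e : ∫ ω, (∫ b, F (x 0 ω) b ∂ν) ^ 2 ∂P = ∫ a, (∫ b, F a b ∂ν) ^ 2 ∂ν := by
    have him := integral_map (μ := P) (hxm 0).aemeasurable (f := fun a => (∫ b, F a b ∂ν) ^ 2)
      (by rw [hlaw]; exact hgm.aestronglyMeasurable)
    rw [hlaw] at him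
    rw [← him]
  rw [e] at h
  filter_upwards [h] with ω hω
  have e' : (fun n : ℕ => (∑ i : Fin n, (∫ b, F (x i ω) b ∂ν) ^ 2) / (n : ℝ))
      = fun n : ℕ => (∑ i ∈ range n, (∫ b, F (x i ω) b ∂ν) ^ 2) / (n : ℝ) := by
    funext n
    rw [Fin.sum_univ_eq_sum_range (fun i => (∫ b, F (x i ω) b ∂ν) ^ 2) n]
  rw [e']
  exact hω

/-- **SEN'S ESTIMATOR OF `ζ₁` IS CONSISTENT IN PROBABILITY.**  For an independent stream `xᵢ`
with common law `ν` and a symmetric measurable kernel `F ∈ L²(ν ⊗ ν)`: with the row means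
`Ĥᵢ = Σ_{j<n, j≠i} F(xᵢ, xⱼ)/(n − 1)` and the U-statistic `Uₙ = Σ_{i≠j<n} F(xᵢ, xⱼ)/(n(n−1))`
(their average), the empirical variance `V̂ₙ = (1/n) Σ_{i<n} (Ĥᵢ − Uₙ)²` converges IN
PROBABILITY to `ζ₁ = ∫ (∫ F(a, b) dν(b))² dν(a) − (∫ F d(ν ⊗ ν))²`, the variance of Hoeffding's
projection (so `4V̂ₙ` estimates the asymptotic variance `4ζ₁` of `√n·Uₙ`). [ours] -/
theorem senVariance_tendstoInMeasure (hxm : ∀ i, Measurable (x i)) (hind : iIndepFun x P)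
    (hlaw : ∀ i, Measure.map (x i) P = ν) {F : X → X → ℝ}
    (hFm : Measurable fun z : X × X => F z.1 z.2) (hF : ∀ a b, F a b = F b a)
    (hF2 : MemLp (fun z : X × X => F z.1 z.2) 2 (ν.prod ν)) :
    TendstoInMeasure P (fun (n : ℕ) ω =>
        (∑ i : Fin n, ((∑ j ∈ univ.erase i, F (x i ω) (x j ω)) / ((n : ℝ) - 1)
            - (∑ z ∈ (univ : Finset (Fin n)).offDiag, F (x z.1 ω) (x z.2 ω))
                / (n * (n - 1) : ℝ)) ^ 2) / (n : ℝ))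
      atTop (fun _ => (∫ a, (∫ b, F a b ∂ν) ^ 2 ∂ν) - (∫ z, F z.1 z.2 ∂(ν.prod ν)) ^ 2) := by
  -- the three probabilistic inputs
  have hAae := meanSqProj_tendsto_ae hxm hind hlaw hFm hF2
  have hUae := ustat₂_tendsto_ae hxm hind hlaw hFm hF hF2
  have hEim := meanSqErr_tendstoInMeasure_zero hxm hind hlaw hFm hF2
  -- the subsequence criterion for convergence in probability
  rw [exists_seq_tendstoInMeasure_atTop_iff
    (fun n => (measurable_senVariance hxm hFm n).aestronglyMeasurable)]
  intro ns hns
  obtain ⟨ns', hns', hEae⟩ := (hEim.comp hns.tendsto_atTop).exists_seq_tendsto_ae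
  refine ⟨ns', hns', ?_⟩
  filter_upwards [hAae, hUae, hEae] with ω hAω hUω hEω
  exact tendsto_senVariance_along (φ := fun k => ns (ns' k))
    (V := fun n => (∑ i : Fin n, ((∑ j ∈ univ.erase i, F (x i ω) (x j ω)) / ((n : ℝ) - 1)
      - (∑ z ∈ (univ : Finset (Fin n)).offDiag, F (x z.1 ω) (x z.2 ω)) / (n * (n - 1) : ℝ)) ^ 2)
        / (n : ℝ))
    (A := fun n => (∑ i : Fin n, (∫ b, F (x i ω) b ∂ν) ^ 2) / (n : ℝ))
    (U := fun n => (∑ z ∈ (univ : Finset (Fin n)).offDiag, F (x z.1 ω) (x z.2 ω))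
      / (n * (n - 1) : ℝ))
    (E := fun n => (∑ i : Fin n, ((∑ j ∈ univ.erase i, (F (x i ω) (x j ω)
      - ∫ b, F (x i ω) b ∂ν)) / ((n : ℝ) - 1)) ^ 2) / (n : ℝ))
    (hns.tendsto_atTop.comp hns'.tendsto_atTop) hAω hUω hEω
    fun n hn => senVariance_sub_le hn (fun i j => F (x i ω) (x j ω)) fun i => ∫ b, F (x i ω) b ∂ν

end Sen

end Summit.Ventures.LatticeQCDFlow.Scoring.CardConsistency

end
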